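import Summits.CriticalPhenomena.PercolationContinuityZ3.Theorems.Transplant.SkelCylRadFrame
import HarnessLib

/-!
# Cross-centre nesting of induced-cylinder balls (the induced triangle inequality), and the graph-ball prism of a NEARBY centre inside a fat
# prism — the two containments the seed-slab reshape (L5.5, p1-g7 / p3-g4 ruling 18:39Z) needs beyond `prism_subset_cylBall`

builds on p205010 (kernel theorem, internal audit signed; external expert review pending) — nothing in this file uses p205010.
Lane `prim-bschramm`, seat `prim-bschramm-p5` (gen 4, the refuter; SHEAR-SCOPE §p5 item 2 / kill-list k2), helper file
(`--supports stmt-CriticalPhenomena-4575`).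

In the product both fat prisms and kit cubes were `B_X`-balls × planar boxes, so "the inner fat prism at the kit centre lies in the seed cube"
(`hSd : frameSeq (msel τ) ⊆ Sd`, `BoxProdZ2CenterRoute.lean:60-71`) was a product of two interval containments.  Generically the seed slab is a
`cylBall` about a step-vertex `t` and the kit's inner fat prism is a `cylBall` about ANOTHER centre `c'`; the containment is the triangle
inequality of the INDUCED cylinder metric plus monotonicity of induced graphs in the vertex set:
* `cylBall_subset_cylBall_of_mem` — `c' ∈ cylBall t ℓ R₀` and `cyl c' m ⊆ cyl t ℓ` give `cylBall c' m ψ ⊆ cylBall t ℓ (R₀ + ψ)`;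
* `cyl_subset_cyl_of_sub_mem_box` — the planar side condition: `φ c' − φ t ∈ Λ_k` and `m + k ≤ ℓ` give `cyl c' m ⊆ cyl t ℓ`;
* `prism_subset_cylBall_of_mem` — `c' ∈ graphBall t r ∩ cyl t ℓ` (so `c' ∈ cylBall t ℓ (cylRadMax ℓ r)` by `prism_subset_cylBall`) and
  `cyl c' m ⊆ cyl t ℓ`, `1 ≤ m`: the graph-ball prism `prism c' ψ m ⊆ cylBall t ℓ (cylRadMax ℓ r + cylRadMax m ψ)` — every radius on the
  right is a constant of `(Φ, ℓ, m, r, ψ)`, fixed before any window (D13 order of constants).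
[cite: KozmaNitzan2024, §4 p. 19 (the wired cube) — the ℤ^d model]
-/

noncomputable section

namespace Summit.CriticalPhenomena.PercolationContinuityZ3.Theorems.Transplant

open Literature.Probability.LatticeModels
open Literature.Barriers.CriticalPhenomena (graphBall graphBall_finite graphBall_mono)
open scoped Classical

namespace PlanarSkeletonConc

variable {V : Type} {G : SimpleGraph V} [G.LocallyFinite] (Φ : PlanarSkeletonConc G)

/-- **Cross-centre nesting (induced triangle inequality)**: if `c'` lies in `cylBall t ℓ R₀` and the cylinder of `c'` of half-width `m` lies
in the cylinder of `t` of half-width `ℓ`, then `cylBall c' m ψ ⊆ cylBall t ℓ (R₀ + ψ)`. [folklore] -/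
theorem cylBall_subset_cylBall_of_mem {t c' : V} {ℓ m R₀ ψ : ℕ} (hc : c' ∈ Φ.cylBall t ℓ R₀)
    (hcyl : Φ.toPlanarSkeleton.cyl c' m ⊆ Φ.toPlanarSkeleton.cyl t ℓ) : Φ.cylBall c' m ψ ⊆ Φ.cylBall t ℓ (R₀ + ψ) := by
  rintro _ ⟨y, ⟨w, hw⟩, rfl⟩
  obtain ⟨z, ⟨q, hq⟩, hz⟩ := hc
  -- the walk `q : t ⟶ z = c'` inside `cyl t ℓ`, then `w : c' ⟶ y` pushed from `cyl c' m` into `cyl t ℓ`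
  obtain ⟨w', hw'⟩ := Skel.exists_walk_induce_mono (G := G) hcyl w
  have hzc : z = ⟨c', hcyl (Φ.toPlanarSkeleton.mem_cyl_self c' m)⟩ := Subtype.ext hz
  subst hzc
  refine ⟨⟨(y : V), hcyl y.2⟩, ⟨q.append w', ?_⟩, rfl⟩
  rw [SimpleGraph.Walk.length_append, hw']
  exact Nat.add_le_add hq hw

/-- **Planar side condition for cylinder nesting**: `φ c' − φ t ∈ Λ_k` and `m + k ≤ ℓ` give `cyl c' m ⊆ cyl t ℓ`. [folklore] -/
theorem cyl_subset_cyl_of_sub_mem_box {t c' : V} {k m ℓ : ℕ} (hk : Φ.φ c' - Φ.φ t ∈ box 2 k) (hml : m + k ≤ ℓ) :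
    Φ.toPlanarSkeleton.cyl c' m ⊆ Φ.toPlanarSkeleton.cyl t ℓ := by
  intro w hw
  rw [PlanarSkeleton.mem_cyl] at hw ⊢
  rw [mem_box] at hw hk ⊢
  intro i
  obtain ⟨h1, h1'⟩ := hw i
  obtain ⟨h2, h2'⟩ := hk i
  have e : (Φ.φ w - Φ.φ t) i = (Φ.φ w - Φ.φ c') i + (Φ.φ c' - Φ.φ t) i := by
    simp only [Pi.sub_apply]; ring
  have hml' : (m : ℤ) + k ≤ ℓ := by exact_mod_cast hml
  rw [e]
  constructor <;> linarith

/-- **The graph-ball prism of a nearby centre inside a fat prism**: for `c' ∈ graphBall t r ∩ cyl t ℓ` with `cyl c' m ⊆ cyl t ℓ` and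
`1 ≤ m`, `1 ≤ ℓ`: `prism c' ψ m ⊆ cylBall t ℓ (cylRadMax ℓ r + cylRadMax m ψ)`. [this work] -/
theorem prism_subset_cylBall_of_mem {t c' : V} {ℓ m r ψ : ℕ} (hℓ : 1 ≤ ℓ) (hm : 1 ≤ m) (hc : c' ∈ graphBall G t r)
    (hc' : c' ∈ Φ.toPlanarSkeleton.cyl t ℓ) (hcyl : Φ.toPlanarSkeleton.cyl c' m ⊆ Φ.toPlanarSkeleton.cyl t ℓ) :
    Φ.toPlanarSkeleton.prism c' ψ m ⊆ Φ.cylBall t ℓ (Φ.cylRadMax ℓ r + Φ.cylRadMax m ψ) := by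
  have h1 : c' ∈ Φ.cylBall t ℓ (Φ.cylRadMax ℓ r) := Φ.prism_subset_cylBall t hℓ r ⟨hc, hc'⟩
  exact (Φ.prism_subset_cylBall c' hm ψ).trans (Φ.cylBall_subset_cylBall_of_mem h1 hcyl)

end PlanarSkeletonConc

end Summit.CriticalPhenomena.PercolationContinuityZ3.Theorems.Transplant

end
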